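import Summits.BirchSwinnertonDyer.Rank1Residual.Additive.KatoDescentTorsionFree
import Summits.BirchSwinnertonDyer.Rank1Residual.Additive.KatoDescentClosedBinders
import Literature.NumberTheory.EllipticCurves.Kato2004.PerrinRiouRatio
import HarnessLib

set_option linter.dupNamespace false
set_option autoImplicit false

/-!
# The image-free Kato descent at a torsion-free member with the `→`-ONLY interface reading
# («`IsOf W p D → KMC W p → D.Conj1210`») in place of the iff `ReadsTrivialKMC IsOf KMC` — and its
# discharge at the CLOSED binders `(IsKatoZetaDescentDatumOf, KatoMainConjectureFine)` by the kernel lemma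
# `conj1210_of_isKatoZetaDescentDatumOf_of_katoMainConjectureFine` (cell `bsd-cm`, seat `bsd-cm-k7r-c4` g13,
# planner pointer D384 «K-CUT-1»; helper `--supports` stmt-BirchSwinnertonDyer-19945; theorems only)

WHY THIS FILE. The Kato–Perrin-Riou skeletons of record on the cruxes 19945 `EllipticUnitValueSevenOfGZK`
(`Cruxes/EllipticUnitValueSevenOfGZK/Lines/kato_perrin_riou_zp.lean`) and 19223 `CccOneLawOnTypeIstarZero`
(`Cruxes/CccOneLawOnTypeIstarZero/Lines/kato_perrin_riou_istar.lean`) carry the PRINT stub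
`stub_readsTrivialKMCFine : ReadsTrivialKMC IsKatoZetaDescentDatumOf KatoMainConjectureFine`, an IFF
(`IsOf W p D → (KMC W p ↔ D.Conj1210)`). Its `→` half is KERNEL (glue p612876,
`Additive.conj1210_of_isKatoZetaDescentDatumOf_of_katoMainConjectureFine`); its `←` half needs the
`(K, γ, I)`-equivariance of height-one lengths and the uniqueness of admissible zeta classes up to `Λˣ` —
neither typed. But the composition path of both crux records (cell bsd-potss part 8b
`TorsionFree.rankOne_missingPPartAt_of_kmc_of_perrinRiou` → `bsdp_seven_…` / `bsdpOnType_…` → the crux by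
name) uses ONLY `.mp` of the reading. This file re-proves that path over the WEAKER binder

  `(hread : ∀ W p D, IsOf W p D → KMC W p → D.Conj1210)`

(§1, proof texts = part 8b's with `(hread W p D hDof).mp hKMC ↦ hread W p D hDof hKMC`; the old reading
implies the binder, `kmcImp_of_readsTrivialKMC`, so every old record is recovered), and DISCHARGES the binder
at the closed pair `(IsOf, KMC) := (IsKatoZetaDescentDatumOf, KatoMainConjectureFine)` (§2,
`conj1210_of_isOf_of_kmcFine` — the glue lemma in binder shape; `rankOne_bsdp_of_kmcFine_of_perrinRiouRatio` at
the closed triple with `PRRatio := Kato2004.PRRatio`). The route-side compositions (19945: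
`…RamifiedSevenEllipticUnitsValueOfKMCImpReading`; 19223: `…InertBadSignedBranchesCccOneOfKMCImpReading`)
import this file; with them the planner can re-point both skeletons and DELETE stub 5 (6 → 5 stubs) honestly.
This module imports no route (`Theses`) file.

HONEST LABEL: every statement is CONDITIONAL on displayed hypotheses (the readings 1♭ / 1″♭ / 3♭ / 4♭ of
cell bsd-potss, GZK, modularity, KMC and PR^× at the pair); the interface slots `IsOf` / `PRRatio` / `KMC`
are section variables used only as hypotheses (§1) or instantiated at closed tree definitions (§2); no
definition, no named fact, no instance, no `sorry`; nothing about Kato's Main Conjecture, Perrin-Riou's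
conjecture or BSD is asserted; no item is closed; BSD is not proved for any curve by any of this.
[cite: BurnsKuriharaSano2019, Thm. 7.3 and Thm. 7.6 (p. 29), Conj. 2.8 (p. 10)]
[cite: Kato2004Asterisque, Conj. 12.10 (p. 224), §14.14 and Lemma 14.15 (pp. 243–244)]
[cite: Miller2011LMS, §1 and Def. 1.1]
-/

noncomputable section

open scoped Classical

open WeierstrassCurve Literature.NumberTheory.EllipticCurves
  Literature.NumberTheory.EllipticCurves.Rank1Residual
  Literature.NumberTheory.EllipticCurves.Rank1Residual.Typed
  Literature.NumberTheory.EllipticCurves.IwasawaAlgebra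
open Summit.BirchSwinnertonDyer.Rank1Residual
open Summit.BirchSwinnertonDyer.Rank1Residual.Additive

namespace Summit.BirchSwinnertonDyer.BirchSwinnertonDyer.Theorems.KatoDescentKMCImpReading

/-! ## §1 The descent at a torsion-free member over the `→`-only reading binder -/

section Descent

variable {IsOf : ∀ (W : WeierstrassCurve ℚ) [W.IsElliptic] [W.IsGloballyMinimal] (p : ℕ) [Fact p.Prime],
  KatoDescentDatum p → Prop}
variable {PRRatio : ∀ (W : WeierstrassCurve ℚ) [W.IsElliptic] [W.IsGloballyMinimal] (p : ℕ)
  [Fact p.Prime], ℚ_[p] → Prop}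
variable {KMC : ∀ (W : WeierstrassCurve ℚ) [W.IsElliptic] [W.IsGloballyMinimal] (p : ℕ), Prop}
variable (W : WeierstrassCurve ℚ) [W.IsElliptic] [W.IsGloballyMinimal] (p : ℕ) [Fact p.Prime]

omit [W.IsElliptic] [W.IsGloballyMinimal] [Fact p.Prime] in
/-- **The iff reading implies the `→`-only binder** (so every record below specialises to cell
bsd-potss's records over `ReadsTrivialKMC IsOf KMC`). [cite: Kato2004Asterisque, Conj. 12.10 (p. 224)] -/
theorem kmcImp_of_readsTrivialKMC (hread : ReadsTrivialKMC IsOf KMC) :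
    ∀ (W : WeierstrassCurve ℚ) [W.IsElliptic] [W.IsGloballyMinimal] (p : ℕ) [Fact p.Prime]
      (D : KatoDescentDatum p), IsOf W p D → KMC W p → D.Conj1210 :=
  fun W _ _ p _ D hDof hKMC ↦ (hread W p D hDof).mp hKMC

omit [W.IsElliptic] [W.IsGloballyMinimal] in
/-- `ord_p #Ш(E)(p) = ord_p #Ш(E)`. [folklore] -/
private theorem padicValNat_primaryComponent_sha (hfin : Finite W.sha) :
    padicValNat p (Nat.card (AddCommGroup.primaryComponent W.sha p)) = padicValNat p W.shaOrder := by
  haveI := hfin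
  unfold WeierstrassCurve.shaOrder
  exact padicValNat_card_addPrimaryComponent p

/-- **Rank `0` at a torsion-free member over the `→`-only binder: `KMC(T_pW) ⇒ MissingPPartAt W p`**
(`p ≠ 2` additive potentially good, `p ∤ #W(ℚ)_tors`; Readings 1♭ / 3♭): KMC realises a datum (3♭), the
binder reads it as Conj. 12.10⁰ on the datum, the tree's descent (`KatoDescentDatum.zetaIndex_eq_h2Card_of_conj1210`,
Kato §14.14–14.15) gives `[A : z] = #H²`, and Reading 1♭ gives `ord_p #Ш = ord_p #Ш_an`. Part 8b's
`TorsionFree.missingPPartAt_rankZero_of_kmc` with `.mp` replaced by application. CONDITIONAL.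
[cite: Kato2004Asterisque, Conj. 12.10 (p. 224), §14.14 and Lemma 14.15 (pp. 243–244), Prop. 14.16 (2) (p. 244)] -/
theorem missingPPartAt_rankZero_of_kmcImp (hR : TorsionFree.DescentCountReading IsOf)
    (hreal : TorsionFree.RealizableOfKMC IsOf KMC)
    (hread : ∀ (W : WeierstrassCurve ℚ) [W.IsElliptic] [W.IsGloballyMinimal] (p : ℕ) [Fact p.Prime]
      (D : KatoDescentDatum p), IsOf W p D → KMC W p → D.Conj1210)
    (hGZK : rank_eq_analyticRank_of_analyticRank_le_one) (hmod : hasEntireLFunction_rat)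
    (hr : W.analyticRank = 0) (hp : p ≠ 2) (hadd : Addv W p) (hj : 0 ≤ padicValRat p W.j)
    (ht : ¬ p ∣ W.torsionOrder) (hKMC : KMC W p) : MissingPPartAt W p := by
  have hL : W.entireLFunction 1 ≠ 0 := (W.analyticRank_eq_zero_iff_holds (hmod W)).mp hr
  have hfin : Finite W.sha := (hGZK W (by rw [hr]; exact zero_le_one)).2
  obtain ⟨D, hDof⟩ := hreal W p hp hadd hj ht hKMC
  obtain ⟨hfinH2, q, hq, hcount⟩ := hR W p D hp hadd hj ht hL hfin hDof
  have hμ : D.zetaIndex = D.h2Card :=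
    D.zetaIndex_eq_h2Card_of_conj1210 hfinH2 (hread W p D hDof hKMC)
  rw [hμ] at hcount
  obtain ⟨q', hq', hv⟩ := TorsionFree.exists_shaAn_eq_of_count W p hGZK hr hL ht hq hcount
  exact ⟨q', hq', by rw [hv]; ring⟩

/-- **Rank ONE at a torsion-free member over the `→`-only binder: `KMC(T_pW) → PR^×(W, p) →
MissingPPartAt W p`** — Burns–Kurihara–Sano Thm. 7.6 at `r = 1` «even in the case of additive reduction»,
in Kato's `𝐇²`-formalism over Readings 1″♭ / 3♭; part 8b's
`TorsionFree.rankOne_missingPPartAt_of_kmc_of_perrinRiou` with `(hread W p D hDof).mp hKMC` replaced by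
`hread W p D hDof hKMC` — the ONLY use of the interface reading on the composition path of the cruxes 19945 /
19223. CONDITIONAL. [cite: BurnsKuriharaSano2019, Thm. 7.6 and Remark 7.7 (p. 29), Hyp. 2.2 (p. 9)]
[cite: Kato2004Asterisque, Conj. 12.10 (p. 224), §14.14 (p. 243)] -/
theorem rankOne_missingPPartAt_of_kmcImp_of_perrinRiou (hC : TorsionFree.RankOneCountReading IsOf PRRatio)
    (hreal : TorsionFree.RealizableOfKMC IsOf KMC)
    (hread : ∀ (W : WeierstrassCurve ℚ) [W.IsElliptic] [W.IsGloballyMinimal] (p : ℕ) [Fact p.Prime]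
      (D : KatoDescentDatum p), IsOf W p D → KMC W p → D.Conj1210)
    (hGZK : rank_eq_analyticRank_of_analyticRank_le_one) (hmod : hasEntireLFunction_rat)
    (hr : W.analyticRank = 1) (hp : p ≠ 2) (hadd : Addv W p) (hj : 0 ≤ padicValRat p W.j)
    (ht : ¬ p ∣ W.torsionOrder) (hPR : PerrinRiouUpToUnitAt PRRatio W p) (hKMC : KMC W p) :
    MissingPPartAt W p := by
  have hfin : Finite W.sha := (hGZK W (by rw [hr])).2
  obtain ⟨D, hDof⟩ := hreal W p hp hadd hj ht hKMC
  obtain ⟨ℒ, hℒ, -, q, hq, hv⟩ := hPR hr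
  obtain ⟨hfinH2, -, hcount⟩ := hC W p D ℒ hr hp hadd hj ht hfin hDof hℒ
  have hμ : D.zetaIndex = D.h2Card :=
    D.zetaIndex_eq_h2Card_of_conj1210 hfinH2 (hread W p D hDof hKMC)
  have hval := hcount 0 (by rw [pow_zero, one_mul]; exact hμ)
  obtain ⟨q', hq', hv'⟩ := TorsionFree.exists_shaAn_eq_of_leadingTerm_eq W p ht
    (W.leadingLCoeff_ne_zero_holds (hmod W)) hq
  refine ⟨q', hq', ?_⟩
  rw [hv', ← hv, hval, padicValNat_primaryComponent_sha W p hfin]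
  push_cast
  ring

/-- **Rank ONE, `BSD(W, p)` itself** (Miller's `BSDp`; `Ш(W)` finite and `rank = r_an` by GZK).
[cite: BurnsKuriharaSano2019, Thm. 7.6 (p. 29)] [cite: Miller2011LMS, §1 and Def. 1.1] -/
theorem rankOne_bsdp_of_kmcImp_of_perrinRiou (hC : TorsionFree.RankOneCountReading IsOf PRRatio)
    (hreal : TorsionFree.RealizableOfKMC IsOf KMC)
    (hread : ∀ (W : WeierstrassCurve ℚ) [W.IsElliptic] [W.IsGloballyMinimal] (p : ℕ) [Fact p.Prime]
      (D : KatoDescentDatum p), IsOf W p D → KMC W p → D.Conj1210)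
    (hGZK : rank_eq_analyticRank_of_analyticRank_le_one) (hmod : hasEntireLFunction_rat)
    (hr : W.analyticRank = 1) (hp : p ≠ 2) (hadd : Addv W p) (hj : 0 ≤ padicValRat p W.j)
    (ht : ¬ p ∣ W.torsionOrder) (hPR : PerrinRiouUpToUnitAt PRRatio W p) (hKMC : KMC W p) :
    BSDp W p :=
  bsdp_of_missingPPartAt W p hGZK (by rw [hr])
    (rankOne_missingPPartAt_of_kmcImp_of_perrinRiou W p hC hreal hread hGZK hmod hr hp hadd hj ht hPR
      hKMC)

/-- **Analytic rank `≤ 1` at a torsion-free member over the `→`-only binder: `KMC(T_pW)`, plus PR^×(W)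
IF `r_an = 1`, ⇒ `MissingPPartAt W p`.** [cite: Kato2004Asterisque, Conj. 12.10 (p. 224)] [cite: BurnsKuriharaSano2019, Thm. 7.6 (p. 29)] -/
theorem missingPPartAt_of_kmcImp_of_perrinRiou (hR : TorsionFree.DescentCountReading IsOf)
    (hC : TorsionFree.RankOneCountReading IsOf PRRatio) (hreal : TorsionFree.RealizableOfKMC IsOf KMC)
    (hread : ∀ (W : WeierstrassCurve ℚ) [W.IsElliptic] [W.IsGloballyMinimal] (p : ℕ) [Fact p.Prime]
      (D : KatoDescentDatum p), IsOf W p D → KMC W p → D.Conj1210)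
    (hGZK : rank_eq_analyticRank_of_analyticRank_le_one)
    (hmod : hasEntireLFunction_rat) (hr : W.analyticRank ≤ 1) (hp : p ≠ 2) (hadd : Addv W p)
    (hj : 0 ≤ padicValRat p W.j) (ht : ¬ p ∣ W.torsionOrder)
    (hPR : W.analyticRank = 1 → PerrinRiouUpToUnitAt PRRatio W p) (hKMC : KMC W p) :
    MissingPPartAt W p := by
  rcases Nat.le_one_iff_eq_zero_or_eq_one.mp hr with h0 | h1
  · exact missingPPartAt_rankZero_of_kmcImp W p hR hreal hread hGZK hmod h0 hp hadd hj ht hKMC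
  · exact rankOne_missingPPartAt_of_kmcImp_of_perrinRiou W p hC hreal hread hGZK hmod h1 hp hadd hj ht
      (hPR h1) hKMC

/-- **… and `BSD(W, p)`** (Miller's `BSDp`). Part 8b's `TorsionFree.bsdp_of_kmc_of_perrinRiou` over the
binder. [cite: Kato2004Asterisque, Conj. 12.10 (p. 224)] [cite: Miller2011LMS, §1 and Def. 1.1] -/
theorem bsdp_of_kmcImp_of_perrinRiou (hR : TorsionFree.DescentCountReading IsOf)
    (hC : TorsionFree.RankOneCountReading IsOf PRRatio) (hreal : TorsionFree.RealizableOfKMC IsOf KMC)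
    (hread : ∀ (W : WeierstrassCurve ℚ) [W.IsElliptic] [W.IsGloballyMinimal] (p : ℕ) [Fact p.Prime]
      (D : KatoDescentDatum p), IsOf W p D → KMC W p → D.Conj1210)
    (hGZK : rank_eq_analyticRank_of_analyticRank_le_one)
    (hmod : hasEntireLFunction_rat) (hr : W.analyticRank ≤ 1) (hp : p ≠ 2) (hadd : Addv W p)
    (hj : 0 ≤ padicValRat p W.j) (ht : ¬ p ∣ W.torsionOrder)
    (hPR : W.analyticRank = 1 → PerrinRiouUpToUnitAt PRRatio W p) (hKMC : KMC W p) : BSDp W p :=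
  bsdp_of_missingPPartAt W p hGZK hr
    (missingPPartAt_of_kmcImp_of_perrinRiou W p hR hC hreal hread hGZK hmod hr hp hadd hj ht hPR hKMC)

/-- **KMC ⇒ Perrin-Riou's NON-VANISHING at a torsion-free rank-one member, over the binder**
(`[A : z] = #H² ≠ 0`; BKS Conj. 2.8 (i)). [cite: BurnsKuriharaSano2019, Conj. 2.8 (i) (p. 10)] [cite: Kato2004Asterisque, Conj. 12.10 (p. 224)] -/
theorem perrinRiou_nonvanishing_of_kmcImp (hC : TorsionFree.RankOneCountReading IsOf PRRatio)
    (hreal : TorsionFree.RealizableOfKMC IsOf KMC)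
    (hread : ∀ (W : WeierstrassCurve ℚ) [W.IsElliptic] [W.IsGloballyMinimal] (p : ℕ) [Fact p.Prime]
      (D : KatoDescentDatum p), IsOf W p D → KMC W p → D.Conj1210)
    (hGZK : rank_eq_analyticRank_of_analyticRank_le_one)
    (hr : W.analyticRank = 1) (hp : p ≠ 2) (hadd : Addv W p) (hj : 0 ≤ padicValRat p W.j)
    (ht : ¬ p ∣ W.torsionOrder) (hKMC : KMC W p) {ℒ : ℚ_[p]} (hℒ : PRRatio W p ℒ) : ℒ ≠ 0 := by
  have hfin : Finite W.sha := (hGZK W (by rw [hr])).2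
  obtain ⟨D, hDof⟩ := hreal W p hp hadd hj ht hKMC
  obtain ⟨hfinH2, hiff, -⟩ := hC W p D ℒ hr hp hadd hj ht hfin hDof hℒ
  have hμ : D.zetaIndex = D.h2Card :=
    D.zetaIndex_eq_h2Card_of_conj1210 hfinH2 (hread W p D hDof hKMC)
  exact hiff.mpr (by rw [hμ]; exact (D.h2Card_pos hfinH2).ne')

end Descent

/-! ## §2 The binder DISCHARGED at the closed pair `(IsKatoZetaDescentDatumOf, KatoMainConjectureFine)` -/

section Closed

/-- **The `→`-only reading at the CLOSED binders is a KERNEL THEOREM** — the glue lemma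
`Additive.conj1210_of_isKatoZetaDescentDatumOf_of_katoMainConjectureFine` (p612876) in the binder shape
`∀ W p D, IsOf W p D → KMC W p → D.Conj1210` at `(IsOf, KMC) := (IsKatoZetaDescentDatumOf, KatoMainConjectureFine)`:
on a datum realising the closed `IsOf`, the closed `KMC` (its ∀-clause applied to the datum's own
`(P.κ, P.γ, P.I, P.eH D.z)`, lengths transported along `P.eH2` and `D.H/ΛD.z ≃ P.I.H/Λ(P.eH D.z)`) gives
Kato's Conj. 12.10 for the datum. This is what discharges the skeletons' `stub_readsTrivialKMCFine` once
their compositions are re-pointed to the `→`-only records. [cite: Kato2004Asterisque, Conj. 12.10 (p. 224)] -/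
theorem conj1210_of_isOf_of_kmcFine :
    ∀ (W : WeierstrassCurve ℚ) [W.IsElliptic] [W.IsGloballyMinimal] (p : ℕ) [Fact p.Prime]
      (D : KatoDescentDatum p), IsKatoZetaDescentDatumOf W p D → KatoMainConjectureFine W p →
      D.Conj1210 :=
  fun _ _ _ _ _ _ hDof hKMC ↦ conj1210_of_isKatoZetaDescentDatumOf_of_katoMainConjectureFine hDof hKMC

/-- **Rank ONE at a torsion-free member, CLOSED TRIPLE: `KatoMainConjectureFine W p →
PerrinRiouUpToUnitAt Kato2004.PRRatio W p → BSD(W, p)`** over the image-free readings 1″♭ / 3♭ of cell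
bsd-potss at `(IsKatoZetaDescentDatumOf, Kato2004.PRRatio, KatoMainConjectureFine)`, GZK and modularity —
NO interface-lemma hypothesis (discharged by `conj1210_of_isOf_of_kmcFine`). CONDITIONAL on the two readings,
GZK, modularity and the two conjecture-grade inputs at the pair; nothing booked.
[cite: BurnsKuriharaSano2019, Thm. 7.6 (p. 29), Conj. 2.8 (ii) (p. 10)] [cite: Kato2004Asterisque, Conj. 12.10 (p. 224)]
[cite: Miller2011LMS, §1 and Def. 1.1] -/
theorem rankOne_bsdp_of_kmcFine_of_perrinRiouRatio
    (hC : TorsionFree.RankOneCountReading IsKatoZetaDescentDatumOf Kato2004.PRRatio)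
    (hreal : TorsionFree.RealizableOfKMC IsKatoZetaDescentDatumOf KatoMainConjectureFine)
    (hGZK : rank_eq_analyticRank_of_analyticRank_le_one) (hmod : hasEntireLFunction_rat)
    (W : WeierstrassCurve ℚ) [W.IsElliptic] [W.IsGloballyMinimal] (p : ℕ) [Fact p.Prime]
    (hr : W.analyticRank = 1) (hp : p ≠ 2) (hadd : Addv W p) (hj : 0 ≤ padicValRat p W.j)
    (ht : ¬ p ∣ W.torsionOrder) (hPR : PerrinRiouUpToUnitAt Kato2004.PRRatio W p)
    (hKMC : KatoMainConjectureFine W p) : BSDp W p :=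
  rankOne_bsdp_of_kmcImp_of_perrinRiou W p hC hreal conj1210_of_isOf_of_kmcFine hGZK hmod hr hp hadd hj
    ht hPR hKMC

end Closed

end Summit.BirchSwinnertonDyer.BirchSwinnertonDyer.Theorems.KatoDescentKMCImpReading

end
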